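import Summits.KontsevichZagierPeriods.KontsevichZagierPeriods.Theorems.HurwitzMicroSectorsNormalFormPrincipleM2FiveZetaTwo
import Literature.NumberTheory.Transcendental.EllIterRep

/-!
# `NormalFormPrinciple` (stmt-KontsevichZagierPeriods-3869), line `SketchIdeator1` — leaf `stub_boxRigidity`,
# dimension two off the product type (`CatalanTwoWays`, half-angle/Möbius/Catalan side): the Möbius product rule

Registered sub-goal `moebius_mul_kit` of the layer `CatalanTwoWays` (lead file `…CatalanArc`).
Write `t₈ = √2 − 1 = tan(π/8)`, `σ₈ = (0, t₈) ⊆ ℝ¹`, `σ₈' = (t₈, 1) ⊆ ℝ¹`, and let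
`c₁(s) = (1 − s t₈)/(s + t₈)`, `c₂(s) = (1 + t₈ s)/(t₈ − s)` be the Möbius factors of the
half-angle base change. We record the semialgebraic data of the arc side: `t₈` is real algebraic,
so `σ₈`, `σ₈'` are `ℚ`-semialgebraic (real algebraic constants are `ℚ`-definable) and so are the
weight `1/(1+s²)`, `1/s`, and `c₁`, `c₂`, `c₁ c₂` on `σ₈` (closure of semialgebraic functions under
`+, −, ·, ⁻¹`, Bochnak–Coste–Roy Prop. 2.2.6, the constant `t₈` being semialgebraic); and, for
`M(v) = [{s ∈ σ₈, 1 ≤ t ≤ v s}, (1/(1+s²))/t]` (any representation with this band as domain and this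
integrand on it), the unfolded product rule `M(c₁ c₂) − M(c₁) − M(c₂) ∈ relations`
(`KZ.of_sub_of_sub_mem_relations_mul`: rule 1a, splitting the band at `t = c₁ s`, and rule 2, the
substitution `t = c₁(s) t'`), using `c₁, c₂ ≥ 1` on `σ₈` (for `c₁`: `s (1 + t₈) < t₈ (1 + t₈) = 1 − t₈`).
References: M. Kontsevich, D. Zagier, *Periods* (2001), §1.2, rules (1), (2). No new definitions.
-/

noncomputable section

open MeasureTheory Set
open Literature.NumberTheory.Transcendental Literature.NumberTheory.Transcendental.KZ
open Literature.ModelTheory.ExponentialFields (IsSemialgebraic)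

namespace Summit.KontsevichZagierPeriods.HurwitzMicroSectors.NormalFormPrinciple.PiBox.M2

/-- `t₈ = √2 − 1` is real algebraic (`(√2)² = 2`). [folklore] -/
private theorem moebMul_isAlgebraic_t₈ : IsAlgebraic ℚ (Real.sqrt 2 - 1) := by
  have h2 : IsAlgebraic ℚ (Real.sqrt 2) := by
    refine IsAlgebraic.of_pow two_pos ?_
    rw [Real.sq_sqrt (by norm_num : (0 : ℝ) ≤ 2)]
    exact isAlgebraic_nat 2
  exact h2.sub isAlgebraic_one

/-- The arc `σ₈ = (0, t₈) ⊆ ℝ¹` is `ℚ`-semialgebraic (its endpoints are real algebraic, hence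
`ℚ`-definable). [folklore] -/
private theorem moebMul_isSemialgebraic_arcLo :
    IsSemialgebraic ℚ {y : Fin 1 → ℝ | 0 < y 0 ∧ y 0 < Real.sqrt 2 - 1} :=
  (isSemialgebraic_setOf_const_lt_apply isAlgebraic_zero 0).inter
    (isSemialgebraic_setOf_apply_lt_const moebMul_isAlgebraic_t₈ 0)

/-- The arc `σ₈' = (t₈, 1) ⊆ ℝ¹` is `ℚ`-semialgebraic. [folklore] -/
private theorem moebMul_isSemialgebraic_arcHi :
    IsSemialgebraic ℚ {y : Fin 1 → ℝ | Real.sqrt 2 - 1 < y 0 ∧ y 0 < 1} :=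
  (isSemialgebraic_setOf_const_lt_apply moebMul_isAlgebraic_t₈ 0).inter
    (isSemialgebraic_setOf_apply_lt_const isAlgebraic_one 0)

/-- The weight `1/(1+s²)` is `ℚ`-semialgebraic on every `ℚ`-semialgebraic `σ ⊆ ℝ¹` (a rational
function with non-vanishing denominator). [folklore] -/
private theorem moebMul_isSemialgebraicFunOn_weight {σ : Set (Fin 1 → ℝ)} (hσ : IsSemialgebraic ℚ σ) :
    IsSemialgebraicFunOn ℚ σ (fun y => 1 / (1 + y 0 ^ 2)) := by
  refine (isSemialgebraicFunOn_aeval_div_aeval hσ 1 (1 + MvPolynomial.X 0 ^ 2 : MvPolynomial (Fin 1) ℚ)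
    fun x _ => ?_).congr fun x _ => by simp
  simp only [map_add, map_one, map_pow, MvPolynomial.aeval_X]
  positivity

/-- `1/s` is `ℚ`-semialgebraic on every `ℚ`-semialgebraic `σ ⊆ ℝ¹` contained in `{0 < s}`.
[folklore] -/
private theorem moebMul_isSemialgebraicFunOn_inv {σ : Set (Fin 1 → ℝ)} (hσ : IsSemialgebraic ℚ σ)
    (h0 : ∀ y ∈ σ, (0:ℝ) < y 0) : IsSemialgebraicFunOn ℚ σ (fun y => 1 / y 0) := by
  refine (isSemialgebraicFunOn_aeval_div_aeval hσ 1 (MvPolynomial.X 0 : MvPolynomial (Fin 1) ℚ)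
    fun x hx => ?_).congr fun x _ => by simp
  simpa using (h0 x hx).ne'

/-- The Möbius factors `c₁(s) = (1 − s t₈)/(s + t₈)`, `c₂(s) = (1 + t₈ s)/(t₈ − s)` and their
product are `ℚ`-semialgebraic on `σ₈ = (0, t₈)`: the constant `t₈` is semialgebraic (real
algebraic), and the denominators `s + t₈`, `t₈ − s` are positive on `σ₈`. [folklore] -/
private theorem moebMul_isSemialgebraicFunOn_moebius :
    IsSemialgebraicFunOn ℚ {y : Fin 1 → ℝ | 0 < y 0 ∧ y 0 < Real.sqrt 2 - 1}
        (fun y => (1 - y 0 * (Real.sqrt 2 - 1)) / (y 0 + (Real.sqrt 2 - 1))) ∧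
      IsSemialgebraicFunOn ℚ {y : Fin 1 → ℝ | 0 < y 0 ∧ y 0 < Real.sqrt 2 - 1}
        (fun y => (1 + (Real.sqrt 2 - 1) * y 0) / ((Real.sqrt 2 - 1) - y 0)) ∧
      IsSemialgebraicFunOn ℚ {y : Fin 1 → ℝ | 0 < y 0 ∧ y 0 < Real.sqrt 2 - 1}
        (fun y => ((1 - y 0 * (Real.sqrt 2 - 1)) / (y 0 + (Real.sqrt 2 - 1))) *
          ((1 + (Real.sqrt 2 - 1) * y 0) / ((Real.sqrt 2 - 1) - y 0))) := by
  have hσ := moebMul_isSemialgebraic_arcLo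
  have hX : IsSemialgebraicFunOn ℚ {y : Fin 1 → ℝ | 0 < y 0 ∧ y 0 < Real.sqrt 2 - 1}
      (fun y => y 0) := isSemialgebraicFunOn_apply hσ 0
  have hT : IsSemialgebraicFunOn ℚ {y : Fin 1 → ℝ | 0 < y 0 ∧ y 0 < Real.sqrt 2 - 1}
      (fun _ => Real.sqrt 2 - 1) := isSemialgebraicFunOn_const_of_isAlgebraic hσ moebMul_isAlgebraic_t₈
  have h1 : IsSemialgebraicFunOn ℚ {y : Fin 1 → ℝ | 0 < y 0 ∧ y 0 < Real.sqrt 2 - 1}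
      (fun _ => (1:ℝ)) := by
    simpa using isSemialgebraicFunOn_ratCast hσ 1
  have hc₁ : IsSemialgebraicFunOn ℚ {y : Fin 1 → ℝ | 0 < y 0 ∧ y 0 < Real.sqrt 2 - 1}
      (fun y => (1 - y 0 * (Real.sqrt 2 - 1)) / (y 0 + (Real.sqrt 2 - 1))) :=
    ((IsSemialgebraicFunOn.sub_holds h1 (IsSemialgebraicFunOn.mul_holds hX hT)).div
      (IsSemialgebraicFunOn.add_holds hX hT) fun y hy => by
        have h : (0:ℝ) < y 0 + (Real.sqrt 2 - 1) := by linarith [hy.1, hy.2]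
        simpa only [Pi.add_apply] using h.ne').congr fun y _ => by simp
  have hc₂ : IsSemialgebraicFunOn ℚ {y : Fin 1 → ℝ | 0 < y 0 ∧ y 0 < Real.sqrt 2 - 1}
      (fun y => (1 + (Real.sqrt 2 - 1) * y 0) / ((Real.sqrt 2 - 1) - y 0)) :=
    ((IsSemialgebraicFunOn.add_holds h1 (IsSemialgebraicFunOn.mul_holds hT hX)).div
      (IsSemialgebraicFunOn.sub_holds hT hX) fun y hy => by
        simpa only [Pi.sub_apply] using (sub_pos.2 hy.2).ne').congr fun y _ => by simp
  exact ⟨hc₁, hc₂, IsSemialgebraicFunOn.mul_holds hc₁ hc₂⟩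

/-- The Möbius factors are at least `1` on `σ₈ = (0, t₈)`, `t₈ = √2 − 1`: for `c₁` this is
`s (1 + t₈) ≤ t₈ (1 + t₈) = 1 − t₈`, for `c₂` it is `t₈ − s ≤ 1 + t₈ s`. [folklore] -/
private theorem moebMul_one_le {y : Fin 1 → ℝ}
    (hy : y ∈ {y : Fin 1 → ℝ | 0 < y 0 ∧ y 0 < Real.sqrt 2 - 1}) :
    1 ≤ (1 - y 0 * (Real.sqrt 2 - 1)) / (y 0 + (Real.sqrt 2 - 1)) ∧
      1 ≤ (1 + (Real.sqrt 2 - 1) * y 0) / ((Real.sqrt 2 - 1) - y 0) := by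
  -- adapted from `one_le_moebius` of `…M2MoebiusKit`
  have hr2 : Real.sqrt 2 ^ 2 = 2 := Real.sq_sqrt (by norm_num)
  have hr1 : 1 < Real.sqrt 2 := by
    rw [Real.lt_sqrt zero_le_one]
    norm_num
  set r := Real.sqrt 2
  obtain ⟨hs0, hst⟩ := hy
  have hr0 : (0:ℝ) < r := by linarith
  constructor
  · rw [le_div_iff₀ (by linarith)]
    nlinarith [mul_pos hr0 (sub_pos.2 hst)]
  · rw [le_div_iff₀ (sub_pos.2 hst)]
    nlinarith [mul_pos hr0 hs0]

/-- **The Möbius product rule (rules 1a + 2).** With `t₈ = √2 − 1`, the Möbius factors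
`c₁(s) = (1 − s t₈)/(s + t₈)`, `c₂(s) = (1 + t₈ s)/(t₈ − s)` and
`M(v) = [{0 < s < t₈, 1 ≤ t ≤ v s}, (1/(1+s²))/t]` (any representation with this band as domain and
this integrand on it): `M(c₁ c₂) − M(c₁) − M(c₂) ∈ relations`, an instance of the unfolded product
rule `log (u w) = log u + log w` (`KZ.of_sub_of_sub_mem_relations_mul`), since `c₁, c₂ ≥ 1` on
`(0, t₈)`. [cite: KontsevichZagier2001, §1.2] -/
theorem moebius_mul_rel (Ms M₁ M₂ : IntegralRep 2)
    (hMsd : Ms.domain = KZlog.band {y : Fin 1 → ℝ | 0 < y 0 ∧ y 0 < Real.sqrt 2 - 1} (fun _ => (1:ℝ))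
      (fun y => ((1 - y 0 * (Real.sqrt 2 - 1)) / (y 0 + (Real.sqrt 2 - 1))) *
        ((1 + (Real.sqrt 2 - 1) * y 0) / ((Real.sqrt 2 - 1) - y 0))))
    (hMsi : EqOn Ms.integrand (fun z => (1 / (1 + z 0 ^ 2)) / z 1) Ms.domain)
    (hM₁d : M₁.domain = KZlog.band {y : Fin 1 → ℝ | 0 < y 0 ∧ y 0 < Real.sqrt 2 - 1} (fun _ => (1:ℝ))
      (fun y => (1 - y 0 * (Real.sqrt 2 - 1)) / (y 0 + (Real.sqrt 2 - 1))))
    (hM₁i : EqOn M₁.integrand (fun z => (1 / (1 + z 0 ^ 2)) / z 1) M₁.domain)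
    (hM₂d : M₂.domain = KZlog.band {y : Fin 1 → ℝ | 0 < y 0 ∧ y 0 < Real.sqrt 2 - 1} (fun _ => (1:ℝ))
      (fun y => (1 + (Real.sqrt 2 - 1) * y 0) / ((Real.sqrt 2 - 1) - y 0)))
    (hM₂i : EqOn M₂.integrand (fun z => (1 / (1 + z 0 ^ 2)) / z 1) M₂.domain) :
    of Ms - of M₁ - of M₂ ∈ relations :=
  KZ.of_sub_of_sub_mem_relations_mul (m := 1)
    (σ := {y : Fin 1 → ℝ | 0 < y 0 ∧ y 0 < Real.sqrt 2 - 1})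
    (g := fun y => 1 / (1 + y 0 ^ 2))
    (u := fun y => (1 - y 0 * (Real.sqrt 2 - 1)) / (y 0 + (Real.sqrt 2 - 1)))
    (w := fun y => (1 + (Real.sqrt 2 - 1) * y 0) / ((Real.sqrt 2 - 1) - y 0))
    moebMul_isSemialgebraic_arcLo moebMul_isSemialgebraicFunOn_moebius.1
    moebMul_isSemialgebraicFunOn_moebius.2.1
    (fun _ hy => (moebMul_one_le hy).1) (fun _ hy => (moebMul_one_le hy).2)
    Ms M₁ M₂ hMsd hMsi hM₁d hM₁i hM₂d hM₂i

/-- **Stub (Möbius product rule + the semialgebraic data of the arc side).** With `t₈ = √2 − 1`,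
`σ₈ = (0, t₈)`, `σ₈' = (t₈, 1) ⊆ ℝ¹` and the Möbius factors `c₁(s) = (1 − s t₈)/(s + t₈)`,
`c₂(s) = (1 + t₈ s)/(t₈ − s)`: `t₈` is real algebraic; `σ₈`, `σ₈'` are `ℚ`-semialgebraic; the
weight `1/(1+s²)` (on `σ₈`, `σ₈'`), `1/s` (on `σ₈'`, `σ₈`) and `c₁`, `c₂`, `c₁ c₂` (on `σ₈`) are
`ℚ`-semialgebraic; and for `M(v) = [{0 < s < t₈, 1 ≤ t ≤ v s}, (1/(1+s²))/t]` the unfolded product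
rule `M(c₁ c₂) − M(c₁) − M(c₂) ∈ relations` holds (rules 1a + 2 of the KZ calculus).
[cite: KontsevichZagier2001, §1.2] -/
theorem moebius_mul_kit :
    IsAlgebraic ℚ (Real.sqrt 2 - 1) ∧
    IsSemialgebraic ℚ {y : Fin 1 → ℝ | 0 < y 0 ∧ y 0 < Real.sqrt 2 - 1} ∧
    IsSemialgebraic ℚ {y : Fin 1 → ℝ | Real.sqrt 2 - 1 < y 0 ∧ y 0 < 1} ∧
    IsSemialgebraicFunOn ℚ {y : Fin 1 → ℝ | 0 < y 0 ∧ y 0 < Real.sqrt 2 - 1}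
      (fun y => (fun s : ℝ => 1 / (1 + s ^ 2)) (y 0)) ∧
    IsSemialgebraicFunOn ℚ {y : Fin 1 → ℝ | Real.sqrt 2 - 1 < y 0 ∧ y 0 < 1}
      (fun y => (fun s : ℝ => 1 / (1 + s ^ 2)) (y 0)) ∧
    IsSemialgebraicFunOn ℚ {y : Fin 1 → ℝ | Real.sqrt 2 - 1 < y 0 ∧ y 0 < 1}
      (fun y => (fun s : ℝ => 1 / s) (y 0)) ∧
    IsSemialgebraicFunOn ℚ {y : Fin 1 → ℝ | 0 < y 0 ∧ y 0 < Real.sqrt 2 - 1}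
      (fun y => (fun s : ℝ => 1 / s) (y 0)) ∧
    IsSemialgebraicFunOn ℚ {y : Fin 1 → ℝ | 0 < y 0 ∧ y 0 < Real.sqrt 2 - 1}
      (fun y => (fun s : ℝ => (1 - s * (Real.sqrt 2 - 1)) / (s + (Real.sqrt 2 - 1))) (y 0)) ∧
    IsSemialgebraicFunOn ℚ {y : Fin 1 → ℝ | 0 < y 0 ∧ y 0 < Real.sqrt 2 - 1}
      (fun y => (fun s : ℝ => (1 + (Real.sqrt 2 - 1) * s) / ((Real.sqrt 2 - 1) - s)) (y 0)) ∧
    IsSemialgebraicFunOn ℚ {y : Fin 1 → ℝ | 0 < y 0 ∧ y 0 < Real.sqrt 2 - 1}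
      (fun y => (fun s : ℝ => ((1 - s * (Real.sqrt 2 - 1)) / (s + (Real.sqrt 2 - 1))) *
        ((1 + (Real.sqrt 2 - 1) * s) / ((Real.sqrt 2 - 1) - s))) (y 0)) ∧
    (∀ (Ms M₁ M₂ : IntegralRep 2),
      Ms.domain = KZlog.band {y : Fin 1 → ℝ | 0 < y 0 ∧ y 0 < Real.sqrt 2 - 1} (fun _ => (1:ℝ))
        (fun y => ((1 - y 0 * (Real.sqrt 2 - 1)) / (y 0 + (Real.sqrt 2 - 1))) *
          ((1 + (Real.sqrt 2 - 1) * y 0) / ((Real.sqrt 2 - 1) - y 0))) →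
      EqOn Ms.integrand (fun z => (1 / (1 + z 0 ^ 2)) / z 1) Ms.domain →
      M₁.domain = KZlog.band {y : Fin 1 → ℝ | 0 < y 0 ∧ y 0 < Real.sqrt 2 - 1} (fun _ => (1:ℝ))
        (fun y => (1 - y 0 * (Real.sqrt 2 - 1)) / (y 0 + (Real.sqrt 2 - 1))) →
      EqOn M₁.integrand (fun z => (1 / (1 + z 0 ^ 2)) / z 1) M₁.domain →
      M₂.domain = KZlog.band {y : Fin 1 → ℝ | 0 < y 0 ∧ y 0 < Real.sqrt 2 - 1} (fun _ => (1:ℝ))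
        (fun y => (1 + (Real.sqrt 2 - 1) * y 0) / ((Real.sqrt 2 - 1) - y 0)) →
      EqOn M₂.integrand (fun z => (1 / (1 + z 0 ^ 2)) / z 1) M₂.domain →
      of Ms - of M₁ - of M₂ ∈ relations) := by
  have ht₈ : (0:ℝ) < Real.sqrt 2 - 1 := by
    rw [sub_pos, Real.lt_sqrt zero_le_one]
    norm_num
  exact ⟨moebMul_isAlgebraic_t₈, moebMul_isSemialgebraic_arcLo, moebMul_isSemialgebraic_arcHi,
    moebMul_isSemialgebraicFunOn_weight moebMul_isSemialgebraic_arcLo,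
    moebMul_isSemialgebraicFunOn_weight moebMul_isSemialgebraic_arcHi,
    moebMul_isSemialgebraicFunOn_inv moebMul_isSemialgebraic_arcHi fun y hy => ht₈.trans hy.1,
    moebMul_isSemialgebraicFunOn_inv moebMul_isSemialgebraic_arcLo fun y hy => hy.1,
    moebMul_isSemialgebraicFunOn_moebius.1, moebMul_isSemialgebraicFunOn_moebius.2.1,
    moebMul_isSemialgebraicFunOn_moebius.2.2, moebius_mul_rel⟩

end Summit.KontsevichZagierPeriods.HurwitzMicroSectors.NormalFormPrinciple.PiBox.M2
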